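import Summits.BirchSwinnertonDyer.BirchSwinnertonDyer.Theorems.EdixhovenFibreFiveSevenPotGoodManinUnitOfSL2NeronValuesBar
import Summits.BirchSwinnertonDyer.BirchSwinnertonDyer.Theorems.TeichmullerTwistDescentManinSideOfReciprocityLaw
import HarnessLib

/-!
# Route `TeichmullerTwistDescent`: the `p ∈ {5, 7}` Manin items SCMU57 (22639), WILD (24306), TAME (24307) BY NAME GRANTED ONLY {modularity, P1-bar}
# — Kato's explicit reciprocity law [REC-tower] eliminated (seat `bsd-line-edix-p4` g31, width, line `kato-lever` of the sibling route EdixhovenFibreFiveSeven)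

HONEST FRAMING. TOOL theorems only (no definition, no named fact, no instance, no `sorry`); helper `--supports` SCMU57 stmt-BirchSwinnertonDyer-22639 of route
TeichmullerTwistDescent (same sub-problem, same rung W-ALL/2.p>=5.r1 as EdixhovenFibreFiveSeven). The three items stay OPEN — they are proved here CONDITIONALLY
on modularity (`exists_isNewformOf`, cite-only) and P1-bar (`Kato2004.exists_member_sl2ZetaElement_neron_values_bar`, print XL, cite-only). **BSD is not proved
by any of this.**

WHAT. `TeichmullerTwistDescentManinSideOfReciprocityLaw` (LEAD edix-p1 g19) derives the seven Manin-side decls of route TeichmullerTwistDescent from {modularity,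
hT₂ / [REC-tower], P1-bar} through `not_dvd_optimal_c_fiveSeven_of_expStarTower_of_sl2NeronValuesBar` (`p ∈ {5, 7}`) and the `p > 7` (G)-ordinary lever. For the
three decls that live entirely at `p ∈ {5, 7}` the hT₂ / [REC-tower] input is now a THEOREM: `PotGoodManinUnitOfSL2NeronValuesBar.not_dvd_optimal_c_potGood_of_sl2NeronValuesBar`
(this seat + LEAD g33: [REC-tower] proved on all twelve potentially good additive cells at `p ∈ {5, 7}`, `recTowerPotGoodFiveSeven`). Hence, VERBATIM the g19 proofs
with that theorem in place of the hT₂ one: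

* ★★★ `supercuspidalOptimalManinUnitFiveSeven_of_sl2NeronValuesBar` — SCMU57 (22639) ⟸ {modularity, P1-bar};
* ★★★ `kummerCornerWildManinUnit_of_sl2NeronValuesBar` — WILD (24306) ⟸ {modularity, P1-bar};
* ★★★ `kummerCornerTameManinUnit_of_sl2NeronValuesBar` — TAME (24307) ⟸ {modularity, P1-bar}.

CORNER (23883) / LOW (23884), shared verbatim by the two routes, are `UnstarredOrdinaryManinUnitOfSL2NeronValuesBar.kummerCornerTorsionOptimalManinUnit_of_sl2NeronValuesBar`
/ `PotGoodManinUnitOfSL2NeronValuesBar.supersingularTorsionOptimalManinUnitFive_of_sl2NeronValuesBar`. NOT covered here: PSMU (22638) and GE11 (23885), whose `p > 7`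
(G)-ordinary cells still take hT₂ (`not_dvd_optimal_c_of_typeGOrd_member_of_expStarTower_of_sl2NeronValuesBar`) — the LEAD's `p ≥ 11` lane. CONDITIONAL; items OPEN.

References: [Kato2004Asterisque] Thm. 6.6 (1), (8.1.3), Thm. 9.7; [Kato1993LNM1553] Ch. II Thm. 1.4.1 (3)–(4); [KostersPannekoek2017] Thm. 1, Cor. 2; [Stevens1989]
Lemma (5.2); [EdixhovenManin1991] Thm. 3; [SilvermanATAEC1994] IV Table 4.1.
-/

set_option autoImplicit false
-- the Theorems namespace of a single-conjunct summit repeats the summit name by design (D-0017)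
set_option linter.dupNamespace false

noncomputable section

open scoped Classical MatrixGroups NumberField

open WeierstrassCurve NumberField IsDedekindDomain Field ValuativeRel
  Literature.NumberTheory.EllipticCurves Literature.NumberTheory.EllipticCurves.ModularForms
  Literature.NumberTheory.EllipticCurves.Rank1Residual Literature.NumberTheory.EllipticCurves.Kato2004
  Literature.NumberTheory.DiophantineGeometry Rat.HeightOneSpectrum
  Literature.NumberTheory.PAdicHodge Literature.NumberTheory.GaloisRepresentations
  Summit.BirchSwinnertonDyer.Rank1Residual Summit.BirchSwinnertonDyer.Rank1Residual.Additive
  Summit.BirchSwinnertonDyer.BirchSwinnertonDyer.Theorems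
  Summit.BirchSwinnertonDyer.BirchSwinnertonDyer.Theorems.PotGoodManinUnitOfSL2NeronValuesBar
  Summit.BirchSwinnertonDyer.BirchSwinnertonDyer.Theses.TeichmullerTwistDescent
  CongruenceSubgroup Complex

namespace Summit.BirchSwinnertonDyer.BirchSwinnertonDyer.Theorems.TeichmullerTwistDescentManinSideFiveSevenOfSL2NeronValuesBar


/-- ★★★ **SCMU57 `SupercuspidalOptimalManinUnitFiveSeven` (stmt-BirchSwinnertonDyer-22639) GRANTED ONLY modularity and P1-bar** — the g19 proof
(`TeichmullerTwistDescentManinSideOfReciprocityLaw.supercuspidalOptimalManinUnitFiveSeven_of_expStarTower_of_sl2NeronValuesBar`) with the hT₂ master theorem replaced by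
`not_dvd_optimal_c_potGood_of_sl2NeronValuesBar` ([REC-tower] proved on the cells); no `Iₙ*` at `W` read off the potentially good member
(`TeichmullerTwistDescent.forall_ne_Istar_of_member`); the supercuspidality binder is not used. CONDITIONAL; the item stays OPEN; BSD is not proved by this.
[cite: Kato2004Asterisque, (8.1.3) (p. 180), Thm. 9.7 (p. 189)] [cite: EdixhovenManin1991, Thm. 3] [cite: Kato1993LNM1553, Ch. II Thm. 1.4.1 (3)–(4)] -/
theorem supercuspidalOptimalManinUnitFiveSeven_of_sl2NeronValuesBar (hnf : exists_isNewformOf)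
    (hP1 : exists_member_sl2ZetaElement_neron_values_bar) :
    SupercuspidalOptimalManinUnitFiveSeven := by
  intro W _ _ p _ N _ D hp57 hadd hirr _ hI hopt
  have hK := (TeichmullerTwistDescent.forall_ne_Istar_iff_placeOf W p).2
    (TeichmullerTwistDescent.forall_ne_Istar_of_member W p (by omega) hI)
  exact not_dvd_optimal_c_potGood_of_sl2NeronValuesBar hP1 hnf W D hp57 hadd hirr hK hopt

/-- ★★★ **WILD `KummerCornerWildManinUnit` (stmt-BirchSwinnertonDyer-24306) GRANTED ONLY modularity and P1-bar** — its cells `(5; III)`, `(7; II)` are unstarred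
(G)-ordinary ([REC-tower] there = `recTowerUnstarredOrdinaryCells`); the (G)-ordinary, torsion and wildness binders are not used. CONDITIONAL; the item stays OPEN.
[cite: Kato2004Asterisque, (8.1.3) (p. 180), Thm. 9.7 (p. 189)] [cite: KostersPannekoek2017, Cor. 2] -/
theorem kummerCornerWildManinUnit_of_sl2NeronValuesBar (hnf : exists_isNewformOf)
    (hP1 : exists_member_sl2ZetaElement_neron_values_bar) :
    KummerCornerWildManinUnit := by
  intro W _ _ p _ _ D hcell hadd hirr _ _ _ hopt
  have hp57 : p = 5 ∨ p = 7 := by rcases hcell with ⟨h, -⟩ | ⟨h, -⟩ <;> simp [h]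
  have h4 : padicValInt p W.minimalDiscriminantInt ≤ 4 := by rcases hcell with ⟨-, h⟩ | ⟨-, h⟩ <;> omega
  exact not_dvd_optimal_c_potGood_of_sl2NeronValuesBar hP1 hnf W D hp57 hadd hirr
    (OptimalManinUnitFiveSevenOfReciprocityLaw.forall_ne_Istar_of_padicValInt_le_four W (by omega) hadd h4) hopt

/-- ★★★ **TAME `KummerCornerTameManinUnit` (stmt-BirchSwinnertonDyer-24307) GRANTED ONLY modularity and P1-bar** — same cells as WILD; the (G)-ordinary, torsion and
tameness binders are not used. CONDITIONAL; the item stays OPEN. [cite: Kato2004Asterisque, (8.1.3) (p. 180), Thm. 9.7 (p. 189)] [cite: KostersPannekoek2017, Cor. 2] -/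
theorem kummerCornerTameManinUnit_of_sl2NeronValuesBar (hnf : exists_isNewformOf)
    (hP1 : exists_member_sl2ZetaElement_neron_values_bar) :
    KummerCornerTameManinUnit := by
  intro W _ _ p _ _ D hcell hadd hirr _ _ _ hopt
  have hp57 : p = 5 ∨ p = 7 := by rcases hcell with ⟨h, -⟩ | ⟨h, -⟩ <;> simp [h]
  have h4 : padicValInt p W.minimalDiscriminantInt ≤ 4 := by rcases hcell with ⟨-, h⟩ | ⟨-, h⟩ <;> omega
  exact not_dvd_optimal_c_potGood_of_sl2NeronValuesBar hP1 hnf W D hp57 hadd hirr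
    (OptimalManinUnitFiveSevenOfReciprocityLaw.forall_ne_Istar_of_padicValInt_le_four W (by omega) hadd h4) hopt

end Summit.BirchSwinnertonDyer.BirchSwinnertonDyer.Theorems.TeichmullerTwistDescentManinSideFiveSevenOfSL2NeronValuesBar

end
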